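import Summits.NavierStokesRegularity.NavierStokesRegularity.Theorems.PerpetualPumpAveragedTypeIBlowupChainContinuationPicard

/-!
# Crux `PerpetualPump.AveragedTypeIBlowup` (stmt-NavierStokesRegularity-1835), line `Sketch`:
# tools for the stub `wellposed` — stability of the restarted Volterra chain, local existence

T. Tao, *Finite time blowup for an averaged three-dimensional Navier–Stokes equation*, J. Amer.
Math. Soc. **29** (2016), 601–674 = arXiv:1402.0290v3, §4, p. 22 (4.14): the wavelet coefficients of
a mild solution of the cascade equation solve the exact Volterra chain
`Y_{i,n}(t) = A 1_{(i,n)=(i₀,n₀)} k_{i,n}(t) + ∫₀ᵗ k_{i,n}(t-s) quadTerm(Y)_{i,n}(s) ds`, `|k_{i,n}| ≤ 1`.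

Helper file (theorems only) for the registered stub `stub_wellposed` of the lead's skeleton
`Cruxes/AveragedTypeIBlowup/Lines/Sketch.lean` (local existence, persistence and Lipschitz
dependence on the datum amplitude `A`), for general continuous kernels `|k_{i,n}| ≤ 1`:

* `restart_dist_le`: two solutions of the restarted chain `X = F + ∫ₐ k quadTerm(X)` on a short
  interval `[a,b]` (`(b-a)Λ ≤ ½`, `Λ = 2Kρ(1+ε₀)^{75/2-35n₀/2}` the weighted Lipschitz modulus of the
  Volterra term, `weighted_volterra_sub_le`) of weighted size `ρ` are `2η`-close in the weight
  `(1+ε₀)^{20n}` when their forcings are `η`-close (the same weighted-supremum argument as the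
  uniqueness theorem `chain_unique`, with a nonzero forcing difference);
* `local_of_kernel`: the chain from the single-mode datum has a solution on `[0,δ)`, `δ` the Picard
  time of `stub_chainContinuationPicard` for the size `(1+ε₀)^{20n₀}|A|` of the datum.

Nothing here closes the item (`--supports`); no statement of the route changes.

## References

* T. Tao, J. Amer. Math. Soc. 29 (2016), 601–674, arXiv:1402.0290v3, §4 p. 22 (4.14).
  [`Tao2016AveragedNS`]
-/

noncomputable section

-- the summit namespace `…NavierStokesRegularity.NavierStokesRegularity…` is the tree convention
set_option linter.dupNamespace false

open MeasureTheory Set Filter Topology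
open scoped ENNReal
open Literature.Analysis.FluidPDE
open Literature.Analysis.FluidPDE.TaoCascade (quadTerm shiftSet mem_shiftSet_iff)

namespace Summit.NavierStokesRegularity.NavierStokesRegularity.Theorems.PerpetualPumpAveragedTypeIBlowup

variable {ε₀ : ℝ} {m : ℕ}

/-! ### Stability of the restarted chain on a short interval -/

/-- **Stability of the restarted Volterra chain on a short interval.** Let `X`, `X'` be continuous
solutions of `X = F + ∫ₐᵗ k(t-s) quadTerm(X)(s) ds`, `X' = F' + ∫ₐᵗ k(t-s) quadTerm(X')(s) ds` on `[a,b]`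
(continuous kernels `|k| ≤ 1`), without modes below `n₀`, of weighted size `(1+ε₀)^{20n}|X|, (1+ε₀)^{20n}|X'| ≤ ρ`
on `[a,b]`, with `(b-a)Λ ≤ ½`, `Λ = 2Kρ(1+ε₀)^{75/2-35n₀/2}`, `K = Σ|α|`. If `(1+ε₀)^{20n}|F - F'| ≤ η` on
`[a,b]` then `(1+ε₀)^{20n}|X - X'| ≤ 2η` on `[a,b]`: the weighted supremum `D` of the difference obeys
`D ≤ η + (b-a)ΛD ≤ η + D/2` by `weighted_volterra_sub_le`. [cite: Tao2016AveragedNS, §4 p. 22 (4.14)] -/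
theorem restart_dist_le (hε₀ : 0 < ε₀) (α : Fin m → Fin m → Fin m → ℤ × ℤ × ℤ → ℝ)
    (k : Fin m → ℤ → ℝ → ℝ) (hk1 : ∀ i n τ, |k i n τ| ≤ 1) (hkc : ∀ i n, Continuous (k i n))
    {K : ℝ} (hK : K = ∑ i₃ : Fin m, ∑ i₁ : Fin m, ∑ i₂ : Fin m, ∑ μ ∈ shiftSet, |α i₁ i₂ i₃ μ|)
    {n₀ : ℤ} {ρ η a b : ℝ} (hρ : 0 ≤ ρ) (hη : 0 ≤ η) (hab : a ≤ b)
    (hbΛ : (b - a) * (K * (2 * ρ) * (1 + ε₀) ^ ((75 : ℝ) / 2 - (35 : ℝ) / 2 * n₀)) ≤ 1 / 2)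
    {X X' F F' : Fin m → ℤ → ℝ → ℝ}
    (hXc : ∀ i n, ContinuousOn (X i n) (Icc a b)) (hX'c : ∀ i n, ContinuousOn (X' i n) (Icc a b))
    (hX0 : ∀ i n t, n < n₀ → X i n t = 0) (hX'0 : ∀ i n t, n < n₀ → X' i n t = 0)
    (hXb : ∀ (i : Fin m) (n : ℤ), ∀ t ∈ Icc a b, (1 + ε₀) ^ ((20 : ℝ) * n) * |X i n t| ≤ ρ)
    (hX'b : ∀ (i : Fin m) (n : ℤ), ∀ t ∈ Icc a b, (1 + ε₀) ^ ((20 : ℝ) * n) * |X' i n t| ≤ ρ)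
    (hXeq : ∀ (i : Fin m) (n : ℤ), ∀ t ∈ Icc a b,
      X i n t = F i n t + ∫ s in a..t, k i n (t - s) * quadTerm ε₀ α X i n s)
    (hX'eq : ∀ (i : Fin m) (n : ℤ), ∀ t ∈ Icc a b,
      X' i n t = F' i n t + ∫ s in a..t, k i n (t - s) * quadTerm ε₀ α X' i n s)
    (hF : ∀ (i : Fin m) (n : ℤ), ∀ t ∈ Icc a b,
      (1 + ε₀) ^ ((20 : ℝ) * n) * |F i n t - F' i n t| ≤ η) :
    ∀ (i : Fin m) (n : ℤ), ∀ t ∈ Icc a b,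
      (1 + ε₀) ^ ((20 : ℝ) * n) * |X i n t - X' i n t| ≤ 2 * η := by
  intro i n t ht
  have hL0 : 0 < 1 + ε₀ := by linarith
  -- clamps onto `[a, b]`
  have hcl : ∀ s, max a (min s b) ∈ Icc a b := fun s =>
    ⟨le_max_left _ _, max_le hab (min_le_right _ _)⟩
  have hclid : ∀ s ∈ Icc a b, max a (min s b) = s := fun s hs => by
    rw [min_eq_left hs.2, max_eq_right hs.1]
  have hcc : Continuous fun s : ℝ => max a (min s b) :=
    continuous_const.max (continuous_id.min continuous_const)
  obtain ⟨Xc, hXc'⟩ : ∃ Xc : Fin m → ℤ → ℝ → ℝ, ∀ j k' s, Xc j k' s = X j k' (max a (min s b)) :=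
    ⟨_, fun _ _ _ => rfl⟩
  obtain ⟨Xc', hXc''⟩ : ∃ Xc' : Fin m → ℤ → ℝ → ℝ, ∀ j k' s, Xc' j k' s = X' j k' (max a (min s b)) :=
    ⟨_, fun _ _ _ => rfl⟩
  have hXcc : ∀ j k', Continuous (Xc j k') := fun j k' => by
    rw [show Xc j k' = fun s => X j k' (max a (min s b)) from funext (hXc' j k')]
    exact (hXc j k').comp_continuous hcc hcl
  have hXc'c : ∀ j k', Continuous (Xc' j k') := fun j k' => by
    rw [show Xc' j k' = fun s => X' j k' (max a (min s b)) from funext (hXc'' j k')]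
    exact (hX'c j k').comp_continuous hcc hcl
  have hXcX : ∀ j k', ∀ s ∈ Icc a b, Xc j k' s = X j k' s := fun j k' s hs => by
    rw [hXc', hclid s hs]
  have hXc'X : ∀ j k', ∀ s ∈ Icc a b, Xc' j k' s = X' j k' s := fun j k' s hs => by
    rw [hXc'', hclid s hs]
  -- the weighted supremum of the difference over `[a, b]` and all modes
  set V : Set ℝ := {x | ∃ (j : Fin m) (k' : ℤ) (s : ℝ), s ∈ Icc a b ∧
    x = (1 + ε₀) ^ ((20 : ℝ) * k') * |X j k' s - X' j k' s|} with hV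
  have hVbdd : BddAbove V := by
    refine ⟨2 * ρ, ?_⟩
    rintro x ⟨j, k', s, hs, rfl⟩
    calc (1 + ε₀) ^ ((20 : ℝ) * k') * |X j k' s - X' j k' s|
        ≤ (1 + ε₀) ^ ((20 : ℝ) * k') * (|X j k' s| + |X' j k' s|) :=
          mul_le_mul_of_nonneg_left (abs_sub _ _) (Real.rpow_nonneg hL0.le _)
      _ ≤ ρ + ρ := by rw [mul_add]; exact add_le_add (hXb j k' s hs) (hX'b j k' s hs)
      _ = 2 * ρ := by ring
  have hVne : V.Nonempty := ⟨_, i, n, t, ht, rfl⟩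
  have hDub : ∀ (j : Fin m) (k' : ℤ) (s : ℝ), s ∈ Icc a b →
      (1 + ε₀) ^ ((20 : ℝ) * k') * |X j k' s - X' j k' s| ≤ sSup V :=
    fun j k' s hs => le_csSup hVbdd ⟨j, k', s, hs, rfl⟩
  have hD0 : 0 ≤ sSup V :=
    le_trans (mul_nonneg (Real.rpow_nonneg hL0.le _) (abs_nonneg _)) (hDub i n t ht)
  -- sizes and distance of the clamped families, everywhere
  have hXcb : ∀ (j : Fin m) (k' : ℤ) (s : ℝ), |Xc j k' s| ≤ ρ * (1 + ε₀) ^ (-((20 : ℝ) * k')) :=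
    fun j k' s => by
      rw [hXc']
      exact (weight_mul_abs_le_iff hL0 _ _ _).1 (hXb j k' _ (hcl s))
  have hXc'b : ∀ (j : Fin m) (k' : ℤ) (s : ℝ), |Xc' j k' s| ≤ ρ * (1 + ε₀) ^ (-((20 : ℝ) * k')) :=
    fun j k' s => by
      rw [hXc'']
      exact (weight_mul_abs_le_iff hL0 _ _ _).1 (hX'b j k' _ (hcl s))
  have hdc : ∀ (j : Fin m) (k' : ℤ) (s : ℝ),
      |Xc j k' s - Xc' j k' s| ≤ sSup V * (1 + ε₀) ^ (-((20 : ℝ) * k')) := fun j k' s => by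
    rw [hXc', hXc'']
    exact (weight_mul_abs_le_iff hL0 _ _ _).1 (hDub j k' _ (hcl s))
  -- every element of `V` is at most `η + D/2`
  have hhalf : ∀ x ∈ V, x ≤ η + sSup V / 2 := by
    rintro x ⟨j, k', s, hs, rfl⟩
    rcases lt_or_ge k' n₀ with hk' | hk'
    · rw [hX0 j k' s hk', hX'0 j k' s hk', sub_zero, abs_zero, mul_zero]
      positivity
    have hI : ∀ {Z Zc : Fin m → ℤ → ℝ → ℝ}, (∀ j'' k'', ∀ u ∈ Icc a b, Zc j'' k'' u = Z j'' k'' u) →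
        ∫ u in a..s, k j k' (s - u) * quadTerm ε₀ α Z j k' u =
          ∫ u in a..s, k j k' (s - u) * quadTerm ε₀ α Zc j k' u := fun hZ =>
      intervalIntegral.integral_congr fun u hu => by
        rw [uIcc_of_le hs.1] at hu
        show k j k' (s - u) * quadTerm ε₀ α _ j k' u = k j k' (s - u) * quadTerm ε₀ α _ j k' u
        rw [quadTerm_congr_at α (fun j'' k'' => (hZ j'' k'' u ⟨hu.1, hu.2.trans hs.2⟩).symm) j k']
    have hsub : X j k' s - X' j k' s = (F j k' s - F' j k' s) +
        ((∫ u in a..s, k j k' (s - u) * quadTerm ε₀ α Xc j k' u) -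
          ∫ u in a..s, k j k' (s - u) * quadTerm ε₀ α Xc' j k' u) := by
      rw [hXeq j k' s hs, hX'eq j k' s hs, hI hXcX, hI hXc'X]
      ring
    have hW := weighted_volterra_sub_le hε₀ α hρ hD0 hXcc hXc'c hXcb hXc'b hdc
      ((hkc j k').comp (continuous_const.sub continuous_id)) (fun u => hk1 j k' (s - u)) j hk' hs.1
      (by linarith [hs.2] : s - a ≤ b - a)
    rw [← hK] at hW
    rw [hsub]
    calc (1 + ε₀) ^ ((20 : ℝ) * k') * |F j k' s - F' j k' s +
          ((∫ u in a..s, k j k' (s - u) * quadTerm ε₀ α Xc j k' u) -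
            ∫ u in a..s, k j k' (s - u) * quadTerm ε₀ α Xc' j k' u)|
        ≤ (1 + ε₀) ^ ((20 : ℝ) * k') * (|F j k' s - F' j k' s| +
            |(∫ u in a..s, k j k' (s - u) * quadTerm ε₀ α Xc j k' u) -
              ∫ u in a..s, k j k' (s - u) * quadTerm ε₀ α Xc' j k' u|) :=
          mul_le_mul_of_nonneg_left (abs_add_le _ _) (Real.rpow_nonneg hL0.le _)
      _ ≤ η + (b - a) * (K * (2 * ρ) * (1 + ε₀) ^ ((75 : ℝ) / 2 - (35 : ℝ) / 2 * n₀)) * sSup V := by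
          rw [mul_add]
          exact add_le_add (hF j k' s hs) hW
      _ ≤ η + 1 / 2 * sSup V := by
          gcongr
      _ = η + sSup V / 2 := by ring
  have hDle : sSup V ≤ η + sSup V / 2 := csSup_le hVne hhalf
  have hD2 : sSup V ≤ 2 * η := by linarith
  exact (hDub i n t ht).trans hD2

/-! ### Local existence for a general kernel -/

/-- **Local existence for general continuous kernels `|k_{i,n}| ≤ 1`.** The chain from the single-mode
datum `A 1_{(i,n)=(i₀,n₀)}` has a continuous solution on some `[0,S)`, `S > 0`, no modes below `n₀`,
`(1+ε₀)^{20n}`-bounded: the Picard theorem `stub_chainContinuationPicard` on `[0,δ]` with the forcing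
`A 1_{(i,n)=(i₀,n₀)} k_{i,n}(t)` of weighted size `(1+ε₀)^{20n₀}|A|`. [cite: Tao2016AveragedNS, §4 p. 22 (4.14)] -/
theorem local_of_kernel (hε₀ : 0 < ε₀) (α : Fin m → Fin m → Fin m → ℤ × ℤ × ℤ → ℝ)
    (k : Fin m → ℤ → ℝ → ℝ) (hk1 : ∀ i n τ, |k i n τ| ≤ 1) (hkc : ∀ i n, Continuous (k i n))
    (i₀ : Fin m) (n₀ : ℤ) (A : ℝ) :
    ∃ (S : ℝ) (Y : Fin m → ℤ → ℝ → ℝ), 0 < S ∧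
      (∀ i n, ContinuousOn (Y i n) (Ico 0 S)) ∧
      (∀ i n t, n < n₀ → Y i n t = 0) ∧
      (∀ S' : ℝ, S' < S → ∃ C : ℝ, ∀ (i : Fin m) (n : ℤ), ∀ t ∈ Icc 0 S',
        (1 + ε₀) ^ ((20 : ℝ) * n) * |Y i n t| ≤ C) ∧
      (∀ (i : Fin m) (n : ℤ), ∀ t ∈ Ico 0 S,
        Y i n t = (if i = i₀ ∧ n = n₀ then A else 0) * k i n t +
          ∫ s in (0 : ℝ)..t, k i n (t - s) * quadTerm ε₀ α Y i n s) := by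
  have hL0 : 0 < 1 + ε₀ := by linarith
  obtain ⟨δ, hδ0, hP⟩ := stub_chainContinuationPicard hε₀ α n₀ ((1 + ε₀) ^ ((20 : ℝ) * n₀) * |A|)
    (by positivity)
  obtain ⟨F, hF⟩ : ∃ F : Fin m → ℤ → ℝ → ℝ, ∀ i n t, F i n t = (if i = i₀ ∧ n = n₀ then A else 0) * k i n t :=
    ⟨_, fun _ _ _ => rfl⟩
  have hFc : ∀ i n, Continuous (F i n) := fun i n => by
    rw [show F i n = fun t => (if i = i₀ ∧ n = n₀ then A else 0) * k i n t from funext (hF i n)]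
    exact continuous_const.mul (hkc i n)
  have hF0 : ∀ i n t, n < n₀ → F i n t = 0 := fun i n t hn => by
    have hne : ¬(i = i₀ ∧ n = n₀) := fun hc => by
      rw [hc.2] at hn
      exact lt_irrefl _ hn
    rw [hF, if_neg hne, zero_mul]
  have hFR : ∀ (i : Fin m) (n : ℤ) (t : ℝ), (1 + ε₀) ^ ((20 : ℝ) * n) * |F i n t| ≤
      (1 + ε₀) ^ ((20 : ℝ) * n₀) * |A| := fun i n t => by
    rw [hF]
    split_ifs with hc
    · rw [abs_mul, hc.2]
      calc (1 + ε₀) ^ ((20 : ℝ) * n₀) * (|A| * |k i n₀ t|) ≤ (1 + ε₀) ^ ((20 : ℝ) * n₀) * (|A| * 1) := by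
            gcongr
            exact hk1 i n₀ t
        _ = _ := by ring
    · rw [zero_mul, abs_zero, mul_zero]
      positivity
  obtain ⟨X, hXc, hX0, hXb, hXeq, -⟩ := hP k F 0 δ hδ0.le (by rw [zero_add]) hk1 hkc hFc hF0 hFR
  refine ⟨δ, X, hδ0, fun i n => (hXc i n).continuousOn, hX0,
    fun S' _ => ⟨2 * ((1 + ε₀) ^ ((20 : ℝ) * n₀) * |A|) + 1, fun i n t _ => hXb i n t⟩, fun i n t ht => ?_⟩
  rw [hXeq i n t ⟨ht.1, ht.2.le⟩, hF]

/-! ### The registered sub-goal -/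

/-- **Registered sub-goal `stub_wellposedRestart` of the stub `wellposed`** (`restart_dist_le`, closed
form): two continuous solutions of the restarted Volterra chain on `[a,b]` (continuous kernels `|k| ≤ 1`,
no modes below `n₀`, weighted size `ρ`, `(b-a)Λ ≤ ½`) whose forcings are `η`-close in the weight
`(1+ε₀)^{20n}` are `2η`-close there. [cite: Tao2016AveragedNS, §4 p. 22 (4.14)] -/
theorem stub_wellposedRestart :
    ∀ {ε₀ : ℝ}, 0 < ε₀ → ∀ {m : ℕ} (α : Fin m → Fin m → Fin m → ℤ × ℤ × ℤ → ℝ)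
      (k : Fin m → ℤ → ℝ → ℝ), (∀ i n τ, |k i n τ| ≤ 1) → (∀ i n, Continuous (k i n)) →
      ∀ (K : ℝ), K = (∑ i₃ : Fin m, ∑ i₁ : Fin m, ∑ i₂ : Fin m, ∑ μ ∈ TaoCascade.shiftSet, |α i₁ i₂ i₃ μ|) →
      ∀ (n₀ : ℤ) (ρ η a b : ℝ), 0 ≤ ρ → 0 ≤ η → a ≤ b →
      (b - a) * (K * (2 * ρ) * (1 + ε₀) ^ ((75 : ℝ) / 2 - (35 : ℝ) / 2 * n₀)) ≤ 1 / 2 →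
      ∀ (X X' F F' : Fin m → ℤ → ℝ → ℝ),
      (∀ i n, ContinuousOn (X i n) (Icc a b)) → (∀ i n, ContinuousOn (X' i n) (Icc a b)) →
      (∀ i n t, n < n₀ → X i n t = 0) → (∀ i n t, n < n₀ → X' i n t = 0) →
      (∀ (i : Fin m) (n : ℤ), ∀ t ∈ Icc a b, (1 + ε₀) ^ ((20 : ℝ) * n) * |X i n t| ≤ ρ) →
      (∀ (i : Fin m) (n : ℤ), ∀ t ∈ Icc a b, (1 + ε₀) ^ ((20 : ℝ) * n) * |X' i n t| ≤ ρ) →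
      (∀ (i : Fin m) (n : ℤ), ∀ t ∈ Icc a b,
        X i n t = F i n t + ∫ s in a..t, k i n (t - s) * quadTerm ε₀ α X i n s) →
      (∀ (i : Fin m) (n : ℤ), ∀ t ∈ Icc a b,
        X' i n t = F' i n t + ∫ s in a..t, k i n (t - s) * quadTerm ε₀ α X' i n s) →
      (∀ (i : Fin m) (n : ℤ), ∀ t ∈ Icc a b, (1 + ε₀) ^ ((20 : ℝ) * n) * |F i n t - F' i n t| ≤ η) →
      ∀ (i : Fin m) (n : ℤ), ∀ t ∈ Icc a b, (1 + ε₀) ^ ((20 : ℝ) * n) * |X i n t - X' i n t| ≤ 2 * η :=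
  fun hε₀ _ α k hk1 hkc _ hK _ _ _ _ _ hρ hη hab hbΛ _ _ _ _ hXc hX'c hX0 hX'0 hXb hX'b hXeq hX'eq hF =>
    restart_dist_le hε₀ α k hk1 hkc hK hρ hη hab hbΛ hXc hX'c hX0 hX'0 hXb hX'b hXeq hX'eq hF

end Summit.NavierStokesRegularity.NavierStokesRegularity.Theorems.PerpetualPumpAveragedTypeIBlowup

end
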